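import Summits.ValiantsHypothesis.ValiantsHypothesis.Theorems.BarrierLeverAnchoredDoorHitsLowerPairsDistinctAnchorsSpec
import Literature.Analysis.TotalPositivity.MultiplyPositiveProofs

/-!
# Support item `AnchoredDoorHitsLowerPairs` (stmt-ValiantsHypothesis-22510), line `anchored-peeling`:
# the ANCHOR-SET EXPANSION of the symbolic layout — `M = P · D_θ · Q` and its Cauchy–Binet form

Helper file (`--supports stmt-ValiantsHypothesis-22510`; cell valiant-natproofs, rung V4, 𝒟-side door (c); registered line
`Cruxes/AnchoredDoorHitsLowerPairs/Lines/anchored_peeling.lean` v5; prover seat val-np-p4 gen 17). Bookkeeping `def`s `xPart`,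
`yPart`, `thetaMon`, `xcoeff`, `ycoeff`, `bigP`, `bigD`, `bigQ`. Closes NO item.

THE STRUCTURE THEOREM OF THE DOOR (every profile `s`, every `h`, honest polynomial identities — no zeon reduction, no
specialisation). The symbolic anchored witness is `∏_{α ∈ anchors s h} (1 + θ_α · xPart α · yPart α)` with the `θ`-free,
one-sided factors `xPart α = x^A ∏_{b ∉ A}(1 + φ_{α b} x_b)` and `yPart α = y^B ∏_{d ∉ B}(1 + ψ_{α d} y_d)` (`α = (A | B)`), so
* `symbolicWitness_eq_sum_powerset`: `symbolicWitness s h = Σ_{J ⊆ anchors s h} θ^J · (∏_{α∈J} xPart α) · (∏_{α∈J} yPart α)`;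
* `coeff_pexpo_mul_of_vars`: the layout coefficient `[x^U y^W]` of (x-only) · (y-only) splits as `[x^U] · [y^W]`;
* `coeff_symbolicWitness_eq_sum` (**entries**): `[x^U y^W] symbolicWitness s h = Σ_{J ⊆ anchors s h} θ^J · xcoeff U J · ycoeff W J`
  with the ONE-SIDED coefficients `xcoeff U J = [x^U] ∏_{α∈J} xPart α`, `ycoeff W J = [y^W] ∏_{α∈J} yPart α`;
* `layout_eq_bigP_mul_bigD_mul_bigQ` (**factorisation**): the layout matrix of `(u, w)` is `P · D_θ · Q` with
  `P[i, J] = xcoeff (u i) J` (rows × anchor sets; depends on `u` and the `x`-twists only), `D_θ = diag(θ^J)`,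
  `Q[J, j] = ycoeff (w j) J` (anchor sets × columns; `w` and the `y`-twists only); hence
* `symbolicDet_eq_det_mul` and the Cauchy–Binet form `symbolicDet_eq_sum_injective`:
  `symbolicDet s h r u w = Σ_{p : Fin r ↪ anchor sets} (∏_i θ^{p i} · ycoeff (w i) (p i)) · det P[·, p]`
  (the tree's `det_mul_eq_sum_pi`; non-injective selections drop out), i.e. grouping `p = t ∘ τ`,
  `symbolicDet = Σ_{𝒥} θ^𝒥 · det P[R, 𝒥] · det Q[𝒥, C]` over `r`-element families `𝒥` of anchor sets.

CONSEQUENCES recorded for the line (memo HOME/val-np-p4/g17/MEMO-anchor-set-expansion-valnp4-g17.md): the two sides DECOUPLE —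
`symbolicDet ≠ 0` needs an `r`-family of anchor sets that is simultaneously a column basis of `P[R, ·]` and a row basis of `Q[·, C]`
(two one-sided linear matroids), and non-cancellation among the families with the same `θ`-multiset; the squarefree families
(every anchor used once) are exactly val-np-p4 g16's distinct-anchor certificates (`…DistinctAnchors`), and beyond `r − 1 > #anchors`
every monomial of `symbolicDet` repeats an anchor. Only anchor sets whose `x`-parts (resp. `y`-parts) are pairwise disjoint have a
nonzero column of `P` (resp. row of `Q`); for `s = 1` these are the partial matchings of `K_{h,h}`.

WHAT THIS IS NOT: an identity, not a hit; nothing on which pairs are hit, on items 22510 / 19717 themselves, on crux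
stmt-ValiantsHypothesis-14610, or on `VP` versus `VNP`.
-/

set_option linter.dupNamespace false

namespace Summit.ValiantsHypothesis.ValiantsHypothesis.Theorems.BarrierLever.AnchoredPeeling

open Finset MvPolynomial
open Summit.ValiantsHypothesis.ValiantsHypothesis.Theorems.BarrierLever.BrickCalculus
  (pexpo pexpo_def pexpo_le_iff pexpo_sub pexpo_apply_castAdd pexpo_apply_natAdd)
open Summit.ValiantsHypothesis.ValiantsHypothesis.Theorems.BarrierLever.ProductStateSums (castAdd_ne_natAdd)

noncomputable section

namespace AnchorSets

variable {h : ℕ}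

/-! ## 1. Layout coefficients of (x-only) · (y-only) -/

/-- **Separation of the two sides.** If every variable of `p` is an `x`-variable and every variable of `q` a `y`-variable,
then `[x^U y^W] (p · q) = [x^U] p · [y^W] q`. -/
theorem coeff_pexpo_mul_of_vars {R : Type*} [CommSemiring R] {p q : MvPolynomial (Fin (h + h)) R}
    (hp : p.vars ⊆ univ.image (Fin.castAdd h)) (hq : q.vars ⊆ univ.image (Fin.natAdd h)) (U W : Finset (Fin h)) :
    coeff (pexpo U W) (p * q) = coeff (pexpo U ∅) p * coeff (pexpo ∅ W) q := by
  classical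
  have hsplit : pexpo U W = pexpo U ∅ + pexpo ∅ W := by
    have := pexpo_union (A := U) (Z := ∅) (B := ∅) (W := W) (Finset.disjoint_empty_right U)
      (Finset.disjoint_empty_left W)
    rwa [Finset.union_empty, Finset.empty_union] at this
  rw [coeff_mul, Finset.sum_eq_single_of_mem ((pexpo U ∅, pexpo ∅ W)) (Finset.HasAntidiagonal.mem_antidiagonal.mpr hsplit.symm)]
  rintro ⟨d₁, d₂⟩ hd hne
  rw [Finset.HasAntidiagonal.mem_antidiagonal] at hd
  by_contra hprod
  have h1 : coeff d₁ p ≠ 0 := left_ne_zero_of_mul hprod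
  have h2 : coeff d₂ q ≠ 0 := right_ne_zero_of_mul hprod
  -- `d₁` has no `y`-variables, `d₂` no `x`-variables
  have hy : ∀ c, d₁ (Fin.natAdd h c) = 0 := fun c => by
    by_contra hc
    have hv : Fin.natAdd h c ∈ p.vars :=
      (mem_vars_iff_mem_support _).mpr ⟨d₁, mem_support_iff.mpr h1, Finsupp.mem_support_iff.mpr hc⟩
    obtain ⟨a, -, ha⟩ := Finset.mem_image.mp (hp hv)
    exact castAdd_ne_natAdd a c ha
  have hx : ∀ a, d₂ (Fin.castAdd h a) = 0 := fun a => by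
    by_contra ha
    have hv : Fin.castAdd h a ∈ q.vars :=
      (mem_vars_iff_mem_support _).mpr ⟨d₂, mem_support_iff.mpr h2, Finsupp.mem_support_iff.mpr ha⟩
    obtain ⟨c, -, hc⟩ := Finset.mem_image.mp (hq hv)
    exact castAdd_ne_natAdd a c hc.symm
  apply hne
  have hd₁ : d₁ = pexpo U ∅ := by
    ext v
    refine Fin.addCases (fun a => ?_) (fun c => ?_) v
    · have := DFunLike.congr_fun hd (Fin.castAdd h a)
      rw [Finsupp.add_apply, hx a, add_zero, pexpo_apply_castAdd] at this
      rw [this, pexpo_apply_castAdd]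
    · rw [hy c, pexpo_apply_natAdd, if_neg (Finset.notMem_empty c)]
  have hd₂ : d₂ = pexpo ∅ W := by
    ext v
    refine Fin.addCases (fun a => ?_) (fun c => ?_) v
    · rw [hx a, pexpo_apply_castAdd, if_neg (Finset.notMem_empty a)]
    · have := DFunLike.congr_fun hd (Fin.natAdd h c)
      rw [Finsupp.add_apply, hy c, zero_add, pexpo_apply_natAdd] at this
      rw [this, pexpo_apply_natAdd]
  rw [hd₁, hd₂]

/-! ## 2. The one-sided parts of an anchor factor -/

/-- The `x`-part of the core of the anchor `α = (A | B)`: `x^A · ∏_{b ∉ A} (1 + φ_{α b} x_b)`. -/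
def xPart (α : Finset (Fin h) × Finset (Fin h)) : MvPolynomial (Fin (h + h)) (MvPolynomial (Param h) ℂ) :=
  (∏ a ∈ α.1, X (Fin.castAdd h a)) * ∏ b ∈ univ \ α.1, (1 + C (X (Sum.inr (Sum.inl (α, b)))) * X (Fin.castAdd h b))

/-- The `y`-part of the core of the anchor `α = (A | B)`: `y^B · ∏_{d ∉ B} (1 + ψ_{α d} y_d)`. -/
def yPart (α : Finset (Fin h) × Finset (Fin h)) : MvPolynomial (Fin (h + h)) (MvPolynomial (Param h) ℂ) :=
  (∏ c ∈ α.2, X (Fin.natAdd h c)) * ∏ d ∈ univ \ α.2, (1 + C (X (Sum.inr (Sum.inr (α, d)))) * X (Fin.natAdd h d))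

/-- `core α = xPart α · yPart α`. -/
theorem core_eq_xPart_mul_yPart (α : Finset (Fin h) × Finset (Fin h)) :
    DistinctAnchors.core α = xPart α * yPart α := by
  rw [DistinctAnchors.core, xPart, yPart]; ring

/-- The anchor factor is `1 + θ_α · (xPart α · yPart α)`. -/
theorem symbFactor_eq_xPart_yPart (α : Finset (Fin h) × Finset (Fin h)) :
    symbFactor h α = 1 + C (X (Sum.inl α)) * (xPart α * yPart α) := by
  rw [DistinctAnchors.symbFactor_eq_core, core_eq_xPart_mul_yPart]

/-- Variables of a product of `X (e a)` lie in any set containing all `e a`. -/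
private theorem vars_prod_X_subset (A : Finset (Fin h)) (e : Fin h → Fin (h + h))
    (S : Finset (Fin (h + h))) (he : ∀ a, e a ∈ S) :
    (∏ a ∈ A, X (e a) : MvPolynomial (Fin (h + h)) (MvPolynomial (Param h) ℂ)).vars ⊆ S := by
  classical
  refine (vars_prod _).trans (Finset.biUnion_subset.mpr fun a _ => ?_)
  rw [vars_X]
  exact Finset.singleton_subset_iff.mpr (he a)

/-- Variables of a twist product `∏_{b ∈ P} (1 + C (t b) · X (e b))` lie in any set containing all `e b`. -/
private theorem vars_prod_twist_subset (P : Finset (Fin h)) (t : Fin h → MvPolynomial (Param h) ℂ)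
    (e : Fin h → Fin (h + h)) (S : Finset (Fin (h + h))) (he : ∀ b, e b ∈ S) :
    (∏ b ∈ P, (1 + C (t b) * X (e b)) : MvPolynomial (Fin (h + h)) (MvPolynomial (Param h) ℂ)).vars ⊆ S := by
  classical
  refine (vars_prod _).trans (Finset.biUnion_subset.mpr fun b _ => ?_)
  refine (vars_add_subset _ _).trans (Finset.union_subset ?_ ?_)
  · rw [vars_one]; exact Finset.empty_subset _
  · refine (vars_mul _ _).trans (Finset.union_subset ?_ ?_)
    · rw [vars_C]; exact Finset.empty_subset _
    · rw [vars_X]; exact Finset.singleton_subset_iff.mpr (he b)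

/-- `xPart α` involves `x`-variables only. -/
theorem vars_xPart_subset (α : Finset (Fin h) × Finset (Fin h)) :
    (xPart α).vars ⊆ univ.image (Fin.castAdd h) := by
  classical
  have he : ∀ a : Fin h, Fin.castAdd h a ∈ univ.image (Fin.castAdd h) :=
    fun a => Finset.mem_image_of_mem _ (Finset.mem_univ a)
  rw [xPart]
  exact (vars_mul _ _).trans (Finset.union_subset (vars_prod_X_subset _ _ _ he) (vars_prod_twist_subset _ _ _ _ he))

/-- `yPart α` involves `y`-variables only. -/
theorem vars_yPart_subset (α : Finset (Fin h) × Finset (Fin h)) :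
    (yPart α).vars ⊆ univ.image (Fin.natAdd h) := by
  classical
  have he : ∀ c : Fin h, Fin.natAdd h c ∈ univ.image (Fin.natAdd h) :=
    fun c => Finset.mem_image_of_mem _ (Finset.mem_univ c)
  rw [yPart]
  exact (vars_mul _ _).trans (Finset.union_subset (vars_prod_X_subset _ _ _ he) (vars_prod_twist_subset _ _ _ _ he))

/-- Products of `x`-parts involve `x`-variables only. -/
theorem vars_prod_xPart_subset (J : Finset (Finset (Fin h) × Finset (Fin h))) :
    (∏ α ∈ J, xPart α).vars ⊆ univ.image (Fin.castAdd h) := by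
  classical
  exact (vars_prod _).trans (Finset.biUnion_subset.mpr fun α _ => vars_xPart_subset α)

/-- Products of `y`-parts involve `y`-variables only. -/
theorem vars_prod_yPart_subset (J : Finset (Finset (Fin h) × Finset (Fin h))) :
    (∏ α ∈ J, yPart α).vars ⊆ univ.image (Fin.natAdd h) := by
  classical
  exact (vars_prod _).trans (Finset.biUnion_subset.mpr fun α _ => vars_yPart_subset α)

/-! ## 3. The anchor-set expansion of the symbolic witness and of its layout coefficients -/

/-- The `θ`-monomial of a set of anchors: `θ^J = ∏_{α ∈ J} θ_α`. -/
def thetaMon (J : Finset (Finset (Fin h) × Finset (Fin h))) : MvPolynomial (Param h) ℂ := ∏ α ∈ J, X (Sum.inl α)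

/-- The one-sided `x`-coefficient of a set of anchors on the row `U`: `[x^U] ∏_{α ∈ J} xPart α`. -/
def xcoeff (U : Finset (Fin h)) (J : Finset (Finset (Fin h) × Finset (Fin h))) : MvPolynomial (Param h) ℂ :=
  coeff (pexpo U ∅) (∏ α ∈ J, xPart α)

/-- The one-sided `y`-coefficient of a set of anchors on the column `W`: `[y^W] ∏_{α ∈ J} yPart α`. -/
def ycoeff (W : Finset (Fin h)) (J : Finset (Finset (Fin h) × Finset (Fin h))) : MvPolynomial (Param h) ℂ :=
  coeff (pexpo ∅ W) (∏ α ∈ J, yPart α)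

/-- **Anchor-set expansion of the symbolic witness:**
`symbolicWitness s h = Σ_{J ⊆ anchors s h} θ^J · (∏_{α ∈ J} xPart α) · (∏_{α ∈ J} yPart α)`. -/
theorem symbolicWitness_eq_sum_powerset (s h : ℕ) :
    symbolicWitness s h =
      ∑ J ∈ (anchors s h).powerset, C (thetaMon J) * ((∏ α ∈ J, xPart α) * ∏ α ∈ J, yPart α) := by
  rw [symbolicWitness_eq_prod, Finset.prod_congr rfl (fun α _ => symbFactor_eq_xPart_yPart α), Finset.prod_one_add]
  refine Finset.sum_congr rfl (fun J _ => ?_)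
  rw [Finset.prod_mul_distrib, Finset.prod_mul_distrib, ← map_prod C, thetaMon]

/-- The layout coefficient of a product of cores splits into the one-sided coefficients. -/
theorem coeff_prod_core (J : Finset (Finset (Fin h) × Finset (Fin h))) (U W : Finset (Fin h)) :
    coeff (pexpo U W) (∏ α ∈ J, DistinctAnchors.core α) = xcoeff U J * ycoeff W J := by
  rw [Finset.prod_congr rfl (fun α _ => core_eq_xPart_mul_yPart α), Finset.prod_mul_distrib,
    coeff_pexpo_mul_of_vars (vars_prod_xPart_subset J) (vars_prod_yPart_subset J), xcoeff, ycoeff]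

/-- **The entries of the symbolic layout, expanded over anchor sets:**
`[x^U y^W] symbolicWitness s h = Σ_{J ⊆ anchors s h} θ^J · xcoeff U J · ycoeff W J`. -/
theorem coeff_symbolicWitness_eq_sum (s h : ℕ) (U W : Finset (Fin h)) :
    coeff (pexpo U W) (symbolicWitness s h) =
      ∑ J ∈ (anchors s h).powerset, thetaMon J * (xcoeff U J * ycoeff W J) := by
  rw [symbolicWitness_eq_sum_powerset, coeff_sum]
  refine Finset.sum_congr rfl (fun J _ => ?_)
  rw [coeff_C_mul, coeff_pexpo_mul_of_vars (vars_prod_xPart_subset J) (vars_prod_yPart_subset J), xcoeff, ycoeff]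

/-- The empty anchor set: `θ^∅ = 1`. -/
theorem thetaMon_empty : thetaMon (∅ : Finset (Finset (Fin h) × Finset (Fin h))) = 1 := by
  rw [thetaMon, Finset.prod_empty]

/-- The empty anchor set reads the empty row only: `xcoeff U ∅ = [U = ∅]`. -/
theorem xcoeff_empty (U : Finset (Fin h)) : xcoeff U ∅ = if U = ∅ then 1 else 0 := by
  classical
  rw [xcoeff, Finset.prod_empty, coeff_one]
  by_cases hU : U = ∅
  · rw [if_pos hU, hU, ProductRule.pexpo_empty_empty, if_pos rfl]
  · rw [if_neg hU, if_neg]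
    intro h0
    apply hU
    have hle : pexpo U ∅ ≤ pexpo (∅ : Finset (Fin h)) ∅ := by rw [ProductRule.pexpo_empty_empty, ← h0]
    exact Finset.subset_empty.mp ((pexpo_le_iff U ∅ ∅ ∅).mp hle).1

/-- The empty anchor set reads the empty column only: `ycoeff W ∅ = [W = ∅]`. -/
theorem ycoeff_empty (W : Finset (Fin h)) : ycoeff W ∅ = if W = ∅ then 1 else 0 := by
  classical
  rw [ycoeff, Finset.prod_empty, coeff_one]
  by_cases hW : W = ∅
  · rw [if_pos hW, hW, ProductRule.pexpo_empty_empty, if_pos rfl]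
  · rw [if_neg hW, if_neg]
    intro h0
    apply hW
    have hle : pexpo ∅ W ≤ pexpo (∅ : Finset (Fin h)) ∅ := by rw [ProductRule.pexpo_empty_empty, ← h0]
    exact Finset.subset_empty.mp ((pexpo_le_iff ∅ W ∅ ∅).mp hle).2

/-! ## 4. The matrix factorisation `M = P · D_θ · Q` and its Cauchy–Binet form -/

variable (s h : ℕ)

/-- The index type of anchor sets: subsets of `anchors s h`. -/
abbrev ASet : Type := ↥((anchors s h).powerset)

/-- `P[i, J] = xcoeff (u i) J` — rows × anchor sets; depends on the rows and the `x`-twists only. -/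
def bigP (r : ℕ) (u : Fin r → Finset (Fin h)) : Matrix (Fin r) (ASet s h) (MvPolynomial (Param h) ℂ) :=
  Matrix.of fun i J => xcoeff (u i) J.1

/-- `Q[J, j] = ycoeff (w j) J` — anchor sets × columns; depends on the columns and the `y`-twists only. -/
def bigQ (r : ℕ) (w : Fin r → Finset (Fin h)) : Matrix (ASet s h) (Fin r) (MvPolynomial (Param h) ℂ) :=
  Matrix.of fun J j => ycoeff (w j) J.1

/-- `D_θ = diag(θ^J)`. -/
def bigD : Matrix (ASet s h) (ASet s h) (MvPolynomial (Param h) ℂ) :=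
  Matrix.diagonal fun J => thetaMon J.1

/-- **The factorisation of the symbolic layout matrix:** `[x^{u i} y^{w j}] symbolicWitness s h = (P · D_θ · Q) i j`. -/
theorem layout_eq_bigP_mul_bigD_mul_bigQ (r : ℕ) (u w : Fin r → Finset (Fin h)) :
    (Matrix.of fun i j : Fin r => coeff (pexpo (u i) (w j)) (symbolicWitness s h)) =
      bigP s h r u * bigD s h * bigQ s h r w := by
  refine Matrix.ext fun i j => ?_
  have hrhs : (bigP s h r u * bigD s h * bigQ s h r w) i j =
      ∑ J : ASet s h, thetaMon J.1 * (xcoeff (u i) J.1 * ycoeff (w j) J.1) := by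
    rw [Matrix.mul_apply]
    refine Finset.sum_congr rfl (fun J _ => ?_)
    rw [bigD, Matrix.mul_diagonal, bigP, bigQ, Matrix.of_apply, Matrix.of_apply]
    ring
  rw [hrhs, Matrix.of_apply, coeff_symbolicWitness_eq_sum]
  exact (Finset.sum_coe_sort ((anchors s h).powerset)
    (fun J => thetaMon J * (xcoeff (u i) J * ycoeff (w j) J))).symm

/-- **The symbolic minor is the determinant of `P · D_θ · Q`.** -/
theorem symbolicDet_eq_det_mul (r : ℕ) (u w : Fin r → Finset (Fin h)) :
    symbolicDet s h r u w = (bigP s h r u * bigD s h * bigQ s h r w).det := by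
  rw [symbolicDet, ← layout_eq_bigP_mul_bigD_mul_bigQ]
  rfl

/-- The rows of `D_θ · Q` are the rows of `Q` scaled by `θ^J`. -/
theorem bigD_mul_bigQ_apply (r : ℕ) (w : Fin r → Finset (Fin h)) (J : ASet s h) (j : Fin r) :
    (bigD s h * bigQ s h r w) J j = thetaMon J.1 * ycoeff (w j) J.1 := by
  rw [bigD, Matrix.diagonal_mul, bigQ, Matrix.of_apply]

/-- **Cauchy–Binet form over ordered selections:** `symbolicDet s h r u w = Σ_{p : Fin r → anchor sets}
(∏_i θ^{p i} · ycoeff (w i) (p i)) · det P[·, p]`. -/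
theorem symbolicDet_eq_sum_pi (r : ℕ) (u w : Fin r → Finset (Fin h)) :
    symbolicDet s h r u w =
      ∑ p : Fin r → ASet s h, (∏ i, thetaMon (p i).1 * ycoeff (w i) (p i).1) * ((bigP s h r u).submatrix id p).det := by
  classical
  rw [symbolicDet_eq_det_mul, Matrix.mul_assoc, Literature.Analysis.TotalPositivity.det_mul_eq_sum_pi]
  refine Finset.sum_congr rfl (fun p _ => ?_)
  rw [Finset.prod_congr rfl (fun i _ => bigD_mul_bigQ_apply s h r w (p i) i)]

/-- **Only injective selections of anchor sets contribute** (a repeated anchor set gives two equal columns of `P[·, p]`):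
`symbolicDet s h r u w = Σ_{p injective} (∏_i θ^{p i} · ycoeff (w i) (p i)) · det P[·, p]`. Grouping `p = t ∘ τ` over the
permutations `τ` of `Fin r` turns the inner sum into `det Q[t, ·]`: the symbolic minor is the sum, over `r`-element families `𝒥`
of anchor sets, of `θ^𝒥 · det P[R, 𝒥] · det Q[𝒥, C]`. -/
theorem symbolicDet_eq_sum_injective (r : ℕ) (u w : Fin r → Finset (Fin h)) :
    symbolicDet s h r u w =
      ∑ p ∈ (univ : Finset (Fin r → ASet s h)).filter (fun p => Function.Injective p),
        (∏ i, thetaMon (p i).1 * ycoeff (w i) (p i).1) * ((bigP s h r u).submatrix id p).det := by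
  classical
  rw [symbolicDet_eq_sum_pi]
  refine (Finset.sum_subset (Finset.filter_subset _ _) fun p _ hp => ?_).symm
  rw [Finset.mem_filter, not_and] at hp
  rw [Literature.Analysis.TotalPositivity.det_submatrix_eq_zero_of_not_injective _ (hp (Finset.mem_univ p)), mul_zero]

end AnchorSets

end

end Summit.ValiantsHypothesis.ValiantsHypothesis.Theorems.BarrierLever.AnchoredPeeling
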